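import Mathlib
import HarnessLib
import Summits.HubbardSuperconductivity.HubbardSuperconductivity.Theorems.KLProgrammeKLRegimeTwoVolumeTowerBaseBlockRowsGeneric
import Summits.HubbardSuperconductivity.HubbardSuperconductivity.Theorems.KLProgrammeKLRegimeTwoVolumeTowerBaseTransferFrameDiff

/-!
# Route `KLProgramme` — crux K3, VL child `KLRegimeVolumeLimitV17F2` (stmt-HubbardSuperconductivity-20440), base of the two-volume tower:
# THE FRAME-DIFFERENCE ROWS AND COLUMNS OF THE ALIVE BLOCK (base atom (ii) = `hDrow/hDcol` of `towerBase_transferData_of_atoms`, conjuncts 4–5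
# of atom `Hbase` of DISCHARGER-GUIDE-g16) REDUCED TO ONE PLAIN TORUS SUM OF THE DIFFERENCE FAMILY (cell gate-hubbard-kl, seat p3 g18;
# `--supports` 20440)

The base of the nested two-volume induction compares the fine volume's base transfer at its own frame `K′ = K_{bL}` with the one at the coarse frame
`K = K_L`; by `…TowerBaseTransferFrameDiff` the difference lives on the alive copies and is the frame difference
`ε • (E(F_0[K′]) − E(F_0[K]))·S_{4M}` of the scale-`0` cross-grid overlap.  The sector analysis matrix is linear in the multiplier family, so this is
the overlap block `ε • E(D)·S_{4M}` of the DIFFERENCE FAMILY `D_ω := F_0[K′]_ω − F_0[K]_ω`, and `…TowerBaseBlockRowsGeneric` (rate `Λ_T = 0`) turns its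
rows and columns into ONE plain product-torus `ℓ¹` norm of the character sum of `D`:

* §1 `sectorAnalysisMatrix_sub_family` — `E(F′) − E(F) = E(F′ − F)` (entrywise linearity); `frameDiffBlock_eq_smulOverlap`;
* §2 **`sum_norm_frameDiffBlock_row_le_of_torusSum`**, **`sum_norm_frameDiffBlock_col_le_of_torusSum`** — if
  `(|β|V²)⁻¹ Σ_{(d,w)} ‖Σ_k D_ω(k) Χ_c(k; d, w)‖ ≤ T` for all `ω`, `c`, then the rows of the frame-difference block are `≤ ε·T` and the columns
  `≤ 2·ε·T` (`ε = imagTimeWeight β M`, `β > 0`) — the literal `hDrow/hDcol` with `δ := 2·ε·T`;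
* §3 **`klBaseTransfer_frameDiff_rows_of_torusSum`** — the same in the base-transfer currency (conjuncts 4–5 of `hdataT` / `Hbase`):
  `Σ_y ‖klBaseTransfer V M β μ K′ x y − klBaseTransfer V M β μ K x y‖ ≤ 2·ε·T` for every label `x`, and the column twin
  (`sum_norm_klBaseTransfer_sub_row_le/_col_le`).

What remains for atom (ii) after this file (OPEN, next file of this seat): the torus bound `T = T_Δ(K′, K)` of the difference family from symbol data —
sup `∝ ε_fr`, support count, second differences `∝ ε_fr` of the padded two-band difference `G(k₀² + e_{K′}²)Z − G(k₀² + e_K²)Z`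
(`…SymbolIncrementSampled`, `…SymbolFrameInstanceSingle`, `sum_norm_charSum_le_of_unitSteps`), `ε_fr ≥ max_{j≤2} coeffNorm_j(K′ ⊖ K)`; on the two
volumes' top flow frames `ε_fr = O(1/L)`, so `δ_L := 2·ε·T_Δ → 0`.  Proofs only; no definition.  Honest framing: bookkeeping; nothing here asserts any
stub of 20440, K3, VL or superconductivity.  [cite: BenfattoGiulianiMastropietro2006, §2.7 (2.70)–(2.71a), §3 (3.3)]
-/

noncomputable section

namespace Summit.HubbardSuperconductivity.HubbardSuperconductivity.Theorems.TwoVolumeSource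

set_option linter.dupNamespace false -- summit = problem name (single-conjunct summit), D-0017

open Finset Complex Literature.MathematicalPhysics.QuantumLattice GrassmannAlgebra Literature.Probability.LatticeModels
open Summit.HubbardSuperconductivity.HubbardSuperconductivity.Theorems.KLProgrammeLegKernels
open Summit.HubbardSuperconductivity.HubbardSuperconductivity.Theorems.KLRegimeSplit
open Summit.HubbardSuperconductivity.HubbardSuperconductivity.Theorems.EngineV8
open Summit.HubbardSuperconductivity.HubbardSuperconductivity.Theorems.TwoVolumeDefect
open scoped ComplexConjugate

variable {V M : ℕ} [NeZero V] [NeZero M]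

/-! ## §1 Linearity: the frame-difference block is the overlap block of the difference family -/

omit [NeZero V] [NeZero M] in
/-- **The sector analysis matrix is linear in the multiplier family**: `E(F′) − E(F) = E(F′ − F)`. [folklore] -/
theorem sectorAnalysisMatrix_sub_family {Ns : ℕ} (β : ℝ) (F' F : Fin Ns → FreqMomentum V M → ℂ) :
    sectorAnalysisMatrix V M β F' - sectorAnalysisMatrix V M β F = sectorAnalysisMatrix V M β (fun ω k => F' ω k - F ω k) := by
  ext Y K
  rw [Matrix.sub_apply, sectorAnalysisMatrix_apply, sectorAnalysisMatrix_apply, sectorAnalysisMatrix_apply]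
  split_ifs
  · ring
  · exact sub_zero 0

omit [NeZero M] in
/-- **The frame-difference block of the scale-`0` overlap is the overlap block of the difference family** `D_ω = F_0[K′]_ω − F_0[K]_ω`. [folklore] -/
theorem frameDiffBlock_eq_smulOverlap (β μ : ℝ) (K' K : TrigPolyC4v) :
    (((imagTimeWeight β M : ℝ) : ℂ) • (sectorAnalysisMatrix V M β (klAnisoFamily V M β μ K' klE0 0) -
        sectorAnalysisMatrix V M β (klAnisoFamily V M β μ K klE0 0))) * hubbardGridSub V M β (klGridN M) =
      (((imagTimeWeight β M : ℝ) : ℂ) • sectorAnalysisMatrix V M β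
          (fun ω k => klAnisoFamily V M β μ K' klE0 0 ω k - klAnisoFamily V M β μ K klE0 0 ω k)) * hubbardGridSub V M β (klGridN M) := by
  rw [sectorAnalysisMatrix_sub_family]

/-! ## §2 Rows and columns of the frame-difference block from ONE plain torus sum of the difference family -/

/-- **`hDrow` FROM THE TORUS SUM OF THE DIFFERENCE FAMILY**: if `(|β|V²)⁻¹ Σ_{(d,w)} ‖Σ_k D_ω(k) Χ_c(k;d,w)‖ ≤ T` for all `ω`, `c`
(`D_ω = F_0[K′]_ω − F_0[K]_ω`), every row of the frame-difference block `ε • (E(F_0[K′]) − E(F_0[K]))·S_{4M}` is `≤ ε·T`.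
[cite: BenfattoGiulianiMastropietro2006, §2.7 (2.71a), §3 (3.3)] -/
theorem sum_norm_frameDiffBlock_row_le_of_torusSum {β : ℝ} (hβ : 0 < β) (μ : ℝ) (K' K : TrigPolyC4v) {T : ℝ}
    (hT : ∀ (ω : Fin (sectorCount 0)) (c : Fin 2), 1 / (|β| * (V : ℝ) ^ 2) *
        ∑ dw : TorusSite 1 (2 * (2 * M)) × TorusSite 2 V,
          ‖∑ k : FreqMomentum V M, (klAnisoFamily V M β μ K' klE0 0 ω k - klAnisoFamily V M β μ K klE0 0 ω k) *
            (if c = 0 then torusChar (fun _ : Fin 1 => ((k.1 : ℕ) : ZMod (2 * (2 * M)))) dw.1 * torusChar k.2 dw.2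
              else conj (torusChar (fun _ : Fin 1 => ((k.1 : ℕ) : ZMod (2 * (2 * M)))) dw.1 * torusChar k.2 dw.2))‖ ≤ T)
    (Y : SpaceTimeIdx V M × SectorLeg (sectorCount 0)) :
    ∑ y : GridLeg (GridPoint V (klGridN M)),
      ‖((((imagTimeWeight β M : ℝ) : ℂ) • (sectorAnalysisMatrix V M β (klAnisoFamily V M β μ K' klE0 0) -
          sectorAnalysisMatrix V M β (klAnisoFamily V M β μ K klE0 0))) * hubbardGridSub V M β (klGridN M)) Y y‖ ≤ imagTimeWeight β M * T := by
  rw [frameDiffBlock_eq_smulOverlap]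
  have h := sum_norm_smulOverlap_mul_wt_row_le_of_torusSum (V := V) (M := M) hβ
    (fun ω k => klAnisoFamily V M β μ K' klE0 0 ω k - klAnisoFamily V M β μ K klE0 0 ω k) (ΛT := 0) (T := T)
    (fun ω c => by simpa only [zero_mul, add_zero, one_mul] using hT ω c) Y
  simpa only [zero_mul, add_zero, mul_one] using h

/-- **`hDcol` FROM THE TORUS SUM OF THE DIFFERENCE FAMILY**: under the same bound every column of the frame-difference block is `≤ 2·ε·T`
(`sectorCount 0 = 2` sectors). [cite: BenfattoGiulianiMastropietro2006, §2.7 (2.71a), §3 (3.3)] -/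
theorem sum_norm_frameDiffBlock_col_le_of_torusSum {β : ℝ} (hβ : 0 < β) (μ : ℝ) (K' K : TrigPolyC4v) {T : ℝ}
    (hT : ∀ (ω : Fin (sectorCount 0)) (c : Fin 2), 1 / (|β| * (V : ℝ) ^ 2) *
        ∑ dw : TorusSite 1 (2 * (2 * M)) × TorusSite 2 V,
          ‖∑ k : FreqMomentum V M, (klAnisoFamily V M β μ K' klE0 0 ω k - klAnisoFamily V M β μ K klE0 0 ω k) *
            (if c = 0 then torusChar (fun _ : Fin 1 => ((k.1 : ℕ) : ZMod (2 * (2 * M)))) dw.1 * torusChar k.2 dw.2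
              else conj (torusChar (fun _ : Fin 1 => ((k.1 : ℕ) : ZMod (2 * (2 * M)))) dw.1 * torusChar k.2 dw.2))‖ ≤ T)
    (y : GridLeg (GridPoint V (klGridN M))) :
    ∑ Y : SpaceTimeIdx V M × SectorLeg (sectorCount 0),
      ‖((((imagTimeWeight β M : ℝ) : ℂ) • (sectorAnalysisMatrix V M β (klAnisoFamily V M β μ K' klE0 0) -
          sectorAnalysisMatrix V M β (klAnisoFamily V M β μ K klE0 0))) * hubbardGridSub V M β (klGridN M)) Y y‖ ≤
      2 * (imagTimeWeight β M * T) := by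
  rw [frameDiffBlock_eq_smulOverlap]
  have h := sum_norm_smulOverlap_mul_wt_col_le_of_torusSum (V := V) (M := M) hβ
    (fun ω k => klAnisoFamily V M β μ K' klE0 0 ω k - klAnisoFamily V M β μ K klE0 0 ω k) (ΛT := 0) (T := T) le_rfl
    (fun ω c => by simpa only [zero_mul, add_zero, one_mul] using hT ω c) y
  have h2 : ((sectorCount 0 : ℕ) : ℝ) = 2 := by simp [sectorCount]
  simpa only [zero_mul, add_zero, mul_one, h2] using h

/-! ## §3 In the base-transfer currency (conjuncts 4–5 of `hdataT` / atom `Hbase`) -/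

/-- **CONJUNCTS 4–5 OF THE BASE-TRANSFER BUNDLE FROM THE TORUS SUM OF THE DIFFERENCE FAMILY**: with `δ := 2·ε·T`,
`Σ_y ‖klBaseTransfer V M β μ K′ x y − klBaseTransfer V M β μ K x y‖ ≤ δ` for every `x : SrcLabel V M 0` and
`Σ_x ‖klBaseTransfer V M β μ K′ x y − klBaseTransfer V M β μ K x y‖ ≤ δ` for every doubled grid leg `y` (in the model `K′ = K_{bL}`, `K = K_L` on the
fine volume `V = bL`). [cite: BenfattoGiulianiMastropietro2006, §2.7 (2.71), §3 (3.3)] -/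
theorem klBaseTransfer_frameDiff_rows_of_torusSum {β : ℝ} (hβ : 0 < β) (μ : ℝ) (K' K : TrigPolyC4v) {T : ℝ} (hT0 : 0 ≤ T)
    (hT : ∀ (ω : Fin (sectorCount 0)) (c : Fin 2), 1 / (|β| * (V : ℝ) ^ 2) *
        ∑ dw : TorusSite 1 (2 * (2 * M)) × TorusSite 2 V,
          ‖∑ k : FreqMomentum V M, (klAnisoFamily V M β μ K' klE0 0 ω k - klAnisoFamily V M β μ K klE0 0 ω k) *
            (if c = 0 then torusChar (fun _ : Fin 1 => ((k.1 : ℕ) : ZMod (2 * (2 * M)))) dw.1 * torusChar k.2 dw.2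
              else conj (torusChar (fun _ : Fin 1 => ((k.1 : ℕ) : ZMod (2 * (2 * M)))) dw.1 * torusChar k.2 dw.2))‖ ≤ T) :
    (∀ x : SrcLabel V M 0, ∑ y : GridLeg (GridPoint V (klGridN M)) × Fin 2,
        ‖klBaseTransfer V M β μ K' x y - klBaseTransfer V M β μ K x y‖ ≤ 2 * (imagTimeWeight β M * T)) ∧
    (∀ y : GridLeg (GridPoint V (klGridN M)) × Fin 2, ∑ x : SrcLabel V M 0,
        ‖klBaseTransfer V M β μ K' x y - klBaseTransfer V M β μ K x y‖ ≤ 2 * (imagTimeWeight β M * T)) := by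
  have hM0 : (0 : ℝ) < M := Nat.cast_pos.2 (Nat.pos_of_ne_zero (NeZero.ne M))
  have hε : 0 ≤ imagTimeWeight β M := by unfold imagTimeWeight; positivity
  have hδ : 0 ≤ 2 * (imagTimeWeight β M * T) := by positivity
  refine ⟨fun x => sum_norm_klBaseTransfer_sub_row_le β μ K' K hδ (fun Y => ?_) x,
    fun y => sum_norm_klBaseTransfer_sub_col_le β μ K' K hδ (fun y' => sum_norm_frameDiffBlock_col_le_of_torusSum hβ μ K' K hT y') y⟩
  have h := sum_norm_frameDiffBlock_row_le_of_torusSum hβ μ K' K hT Y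
  have hT' : imagTimeWeight β M * T ≤ 2 * (imagTimeWeight β M * T) := by nlinarith [mul_nonneg hε hT0]
  exact h.trans hT'

end Summit.HubbardSuperconductivity.HubbardSuperconductivity.Theorems.TwoVolumeSource

end
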